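import Literature.NumberTheory.EllipticCurves.PAdicOneVariableLubinTateTowerMomentsTwo
import Literature.NumberTheory.GaloisRepresentations.LubinTateColemanTraceKernelTwo
import HarnessLib

/-!
# `p = 2`: the log-free measure of a NORM-COHERENT UNIT `β` of the Lubin–Tate tower of `f' = π'X + X²` —
# support on `ℤ₂^×`, the socket, and the moments `∫_{Γ_F} 𝟙_{U_0} κ^{k+1} dD_β = [S^0] D^k (θ((δβ)~ ∘ ϑ))`

Topic `NumberTheory/EllipticCurves`; namespace `Literature.NumberTheory.EllipticCurves`.

De Shalit, *Iwasawa theory of elliptic curves with complex multiplication* (1987), I.3.3–3.5 for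
`β ∈ 𝒰 = lim← U(k_ξ^n)`: from the Coleman power series `g_β` one forms the log-free, trace-zero series
`(δβ)~ = δg_β − u·(δg_β) ∘ f'` (`u = π'/2`; tree `NormCoherentUnits.logDeriv`, `tildeSer`,
`colemanTrace_tildeSer_logDeriv : 𝒮((δβ)~) = 0`, cf2c-w7's `LubinTateColemanTraceKernelTwo.lean`), and the
files `PadicTwoSupportOfColemanTrace.lean` / `PAdicOneVariableLubinTateTowerMomentsTwo.lean` turn ANY trace-zero
series into a measure on `ℤ₂^×` pulled back to `Γ_F` with the moment formula.  This file is the one-line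
composition, stated for `β` itself:

* ★★★ `invAmice₁_μ_eq_zero_normCoherentUnits` — the distribution of `H_β := θ((δβ)~ ∘ ϑ) ∈ ℂ_2⟦S⟧` vanishes on
  every non-unit class (de Shalit (7′): `μ_β` lives on `ℤ₂^×`);
* ★★★ `integral_comap_ltCharacter_pow_succ_normCoherentUnits` — along the Lubin–Tate tower of `f'` and
  `κ = e ∘ χ_{π'}`: **`∫_{Γ_F} 𝟙_{U_0}(σ) κ(σ)^{k+1} d(comap (restrictUnits (x⁻¹·D_{H_β})) ψ)(σ) = [S^0] D^k H_β`**
  (de Shalit (10)+(11) for the log-free measure `ν_β = κμ_β`), for any continuous `θ : ℂ_F → ℂ_[2]` of norm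
  `≤ 1` on `𝒪_{ℂ_F}` reaching the `2`-power roots of unity.

Everything is proved; no named facts, no definitions, no instances (section-local instance attributes as in the
siblings), no `sorry`.

## References

* [deShalit1987] E. de Shalit, *Iwasawa theory of elliptic curves with complex multiplication* (1987),
  I.3.3 (6)–(9) (p. 17–18), I.3.4 (10), I.3.5 (11) (p. 18).
-/

noncomputable section

open MvPowerSeries Filter
open scoped PowerSeries.WithPiTopology Topology Classical

namespace Literature.NumberTheory.EllipticCurves

section NormCoherentUnitMomentsTwo

open ValuativeRel IsLocalRing Field
open Literature.NumberTheory.GaloisRepresentations Literature.NumberTheory.GaloisRepresentations.IsNonarchimedeanLocalField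
  Literature.NumberTheory.GaloisRepresentations.LubinTate Literature.NumberTheory.PAdicHodge

variable {F : Type} [Field F] [ValuativeRel F] [TopologicalSpace F] [IsNonarchimedeanLocalField F]

attribute [local instance] ltNormUniformSpace ltNormIsUniformAddGroup rk1 nF nE fintypeResidueField
attribute [local instance] ltTower_U_normal

variable (hq : residueFieldCard F = 2) (h2 : (valuation F).IsUniformizer (((2 : ℕ) : 𝒪[F]) : F))
  {σ₀ : absoluteGaloisGroup F} (hσ₀ : IsAbsArithFrob σ₀) (u : 𝒪[F]ˣ)
  {ε : (maxUnramifiedCompletion F)ˣ}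
  (hε : maxUnramifiedCompletion.galAut F σ₀ (ε : maxUnramifiedCompletion F) =
    algebraMap 𝒪[F] (maxUnramifiedCompletion F) (u : 𝒪[F]) * (ε : maxUnramifiedCompletion F))
variable (θ : CompletedAlgClosure F →+* ℂ_[2]) (hθc : Continuous θ)
  (hθ1 : ∀ z : CBall F, ‖θ (z : CompletedAlgClosure F)‖ ≤ 1)
  (hθζ : ∀ ζ' : ℂ_[2], (∃ n : ℕ, ζ' ^ 2 ^ n = 1) →
    ∃ ζ : CompletedAlgClosure F, (∃ n : ℕ, ζ ^ 2 ^ n = 1) ∧ θ ζ = ζ')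

include hq in
/-- `π' = 2·u` read in `LTCoeff F` (the hypothesis `hu` of the tree's `tildeSer` lemmas at `q = 2`).
[cite: deShalit1987, I.3.3 (7) (p. 17)] -/
theorem of_unit_mul_two_eq (v : 𝒪[F]ˣ) :
    LTCoeff.of F (((v : 𝒪[F]) * ((2 : ℕ) : 𝒪[F]) : 𝒪[F])) = residueFieldCard F * LTCoeff.of F (v : 𝒪[F]) := by
  rw [map_mul, map_natCast, hq, Nat.cast_ofNat, mul_comm]

include hq hθc hθζ in
/-- ★★★ **The log-free measure of a norm-coherent unit lives on `ℤ₂^×`**: for `β ∈ 𝒰` (tower of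
`f' = π'X + X²`, `π' = 2u`) and `H_β := θ((δβ)~ ∘ ϑ)`, `D_{H_β}` vanishes on every non-unit class of `ℤ/2^{N+1}`.
[cite: deShalit1987, I.3.3 (7)–(7′) (p. 17)] -/
theorem invAmice₁_μ_eq_zero_normCoherentUnits (n : ℕ) (β : NormCoherentUnits (isUniformizer_unit_mul h2 u))
    (N : ℕ) (b : ZMod (2 ^ (N + 1))) (hb : ¬IsUnit b) :
    (invAmice₁ 2 ((PowerSeries.subst ((compSeriesC h2 hσ₀ u hε).map (algebraMap (UnrCoeff F) (CBall F)))
        ((tildeSer ((u : 𝒪[F]) * ((2 : ℕ) : 𝒪[F])) (LTCoeff.of F (u : 𝒪[F])) β.logDeriv).map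
          ((algebraMap (UnrCoeff F) (CBall F)).comp
            ((intToUnrCoeff F).comp (LTCoeff.of F).symm.toRingHom)))).map (θ.comp (CBall F).subtype))
        (norm_coeff_map_le_one θ hθ1
          (PowerSeries.subst ((compSeriesC h2 hσ₀ u hε).map (algebraMap (UnrCoeff F) (CBall F)))
            ((tildeSer ((u : 𝒪[F]) * ((2 : ℕ) : 𝒪[F])) (LTCoeff.of F (u : 𝒪[F])) β.logDeriv).map
              ((algebraMap (UnrCoeff F) (CBall F)).comp
                ((intToUnrCoeff F).comp (LTCoeff.of F).symm.toRingHom)))))).μ (N + 1) b = 0 :=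
  invAmice₁_μ_eq_zero_of_colemanTrace_eq_zero hq h2 hσ₀ u hε θ hθc hθ1 hθζ n _
    (colemanTrace_tildeSer_logDeriv (isUniformizer_unit_mul h2 u) n (of_unit_mul_two_eq hq u) β) N b hb

variable (e : 𝒪[F] ≃+* ℤ_[2])
  (ψ : (n : ℕ) → absoluteGaloisGroup F ⧸ (ltTower (isUniformizer_unit_mul h2 u)).U n → ZMod (2 ^ (n + 1)))
  (hψ : ∀ (n : ℕ) (σ : absoluteGaloisGroup F), σ ∈ (ltTower (isUniformizer_unit_mul h2 u)).U 0 →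
    ψ n ((ltTower (isUniformizer_unit_mul h2 u)).proj n σ) = PadicInt.toZModPow (n + 1)
      (((Units.map (e : 𝒪[F] →+* ℤ_[2]).toMonoidHom).comp (lubinTateCharHom (isUniformizer_unit_mul h2 u)) σ :
        ℤ_[2]ˣ) : ℤ_[2]))

include hq hθc hθζ in
/-- ★★★ **De Shalit's (10)+(11) for a norm-coherent unit at `p = 2`**: along the Lubin–Tate tower of `f'` and
`κ = e ∘ χ_{π'}`, with `H_β := θ((δβ)~ ∘ ϑ)`:
**`∫_{Γ_F} 𝟙_{U_0}(σ) κ(σ)^{k+1} d(comap (restrictUnits (x⁻¹·D_{H_β})) ψ)(σ) = [S^0] D^k H_β`** for every `k`.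
[cite: deShalit1987, I.3.4 (10), I.3.5 (11) (p. 18)] -/
theorem integral_comap_ltCharacter_pow_succ_normCoherentUnits (n : ℕ)
    (β : NormCoherentUnits (isUniformizer_unit_mul h2 u)) (k : ℕ) :
    (GroupDistribution.comap (restrictUnits ((invAmice₁ 2
        ((PowerSeries.subst ((compSeriesC h2 hσ₀ u hε).map (algebraMap (UnrCoeff F) (CBall F)))
          ((tildeSer ((u : 𝒪[F]) * ((2 : ℕ) : 𝒪[F])) (LTCoeff.of F (u : 𝒪[F])) β.logDeriv).map
            ((algebraMap (UnrCoeff F) (CBall F)).comp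
              ((intToUnrCoeff F).comp (LTCoeff.of F).symm.toRingHom)))).map (θ.comp (CBall F).subtype))
        (norm_coeff_map_le_one θ hθ1
          (PowerSeries.subst ((compSeriesC h2 hσ₀ u hε).map (algebraMap (UnrCoeff F) (CBall F)))
            ((tildeSer ((u : 𝒪[F]) * ((2 : ℕ) : 𝒪[F])) (LTCoeff.of F (u : 𝒪[F])) β.logDeriv).map
              ((algebraMap (UnrCoeff F) (CBall F)).comp
                ((intToUnrCoeff F).comp (LTCoeff.of F).symm.toRingHom)))))).density
        (ProfiniteTower.padicInt_isUniform 2) (unitInv ℂ_[2]) uniformContinuous_unitInv norm_unitInv_le))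
        ψ ((ltTower (isUniformizer_unit_mul h2 u)).cellMap_trans _ ψ hψ)
        ((ltTower (isUniformizer_unit_mul h2 u)).cellMap_injective _
          (mem_ltTower_iff (isUniformizer_unit_mul h2 u) e) ψ hψ)
        ((ltTower (isUniformizer_unit_mul h2 u)).cellMap_fiberSurj _
          (mem_ltTower_iff (isUniformizer_unit_mul h2 u) e)
          (exists_toZModPow_ltCharacter_eq (isUniformizer_unit_mul h2 u) e) ψ hψ)).integral
        (fun σ ↦ (if (ltTower (isUniformizer_unit_mul h2 u)).proj 0 σ = 1 then (1 : ℂ_[2]) else 0) *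
          padicIntCast ℂ_[2]
            ((((Units.map (e : 𝒪[F] →+* ℤ_[2]).toMonoidHom).comp (lubinTateCharHom (isUniformizer_unit_mul h2 u))
              σ : ℤ_[2]ˣ) : ℤ_[2]) ^ (k + 1))) =
      PowerSeries.constantCoeff (mahlerD^[k]
        ((PowerSeries.subst ((compSeriesC h2 hσ₀ u hε).map (algebraMap (UnrCoeff F) (CBall F)))
          ((tildeSer ((u : 𝒪[F]) * ((2 : ℕ) : 𝒪[F])) (LTCoeff.of F (u : 𝒪[F])) β.logDeriv).map
            ((algebraMap (UnrCoeff F) (CBall F)).comp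
              ((intToUnrCoeff F).comp (LTCoeff.of F).symm.toRingHom)))).map (θ.comp (CBall F).subtype))) :=
  integral_comap_ltCharacter_pow_succ_of_colemanTrace_eq_zero hq h2 hσ₀ u hε θ hθc hθ1 hθζ e ψ hψ n _
    (colemanTrace_tildeSer_logDeriv (isUniformizer_unit_mul h2 u) n (of_unit_mul_two_eq hq u) β) k

end NormCoherentUnitMomentsTwo

end Literature.NumberTheory.EllipticCurves

end
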